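import Summits.BirchSwinnertonDyer.BirchSwinnertonDyer.Theorems.ByReductionTypeAtTwoOrdKatoHalfAtTwoIsoConjATwoCubicModelOfClassicalMu
import Summits.BirchSwinnertonDyer.BirchSwinnertonDyer.Theorems.ByReductionTypeAtTwoAdditivePotMultConjATwoCubicModelTransport
import Literature.NumberTheory.EllipticCurves.Rank1Residual.Predicates
import HarnessLib

/-!
# C4″ `AdditivePotMultOverKAtTwo` (item stmt-BirchSwinnertonDyer-22618), the «irreducible Kato 12.10» input of the upper half:
# statement (A) at `2` for EVERY integral `W/ℚ` with `Δ < 0` and irreducible `E[2]` from `μ₂ = 0` of the CUBIC field `ℚ(x(T))` —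
# the general-model cubic-field door — and the split of v11's binder (I1M′) `hAnaMI` by the sign of `Δ`

Cell `bsd-2adic`, seat `bsd-2adic-k4-w3` GEN 9 (explicit unit (309)(7); `--supports 22618`). HONEST FRAMING (D-0036/D-0054): THEOREMS
ONLY — no definition, no named fact, no `sorry`; closes nothing at the `∀`-level; nothing booked; BSD is not proved by any of this.
Iwasawa's `μ₂ = 0` for a non-Galois cubic field is OPEN in general (per-field certificates only).

WHY. On the additive potentially multiplicative block of C4″ the Kato side of v11 (`additiveRankZeroAtTwo_of_residual_v11`) displays ONE
research `∀`-object on the irreducible-`E[2]` rows: (I1M′) `hAnaMI` = Coates–Sujatha's statement (A) at `(W, 2)` (Kato Conj. 12.10's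
companion) for the non-abelian-`ℚ(E[2])` pot-mult curves (350 classes of the census; 269 of them with `Δ < 0`). The K4 cone holds, KERNEL and
reduction-type-free (cruxlead-19573-w2 GEN 7): `TotallyComplexMu.conjA_two_cubicModel_of_classicalMu_of_discr_neg` (for `y² = x³+px²+qx+r`,
`disc < 0`: (A)₂ ⟸ `μ₂ = 0` of the CUBIC field `ℚ(β)` alone), whose HANDOFF left «general Weierstrass models `[a₁,…,a₆]`» open; v11's
binder quantifies over GLOBALLY MINIMAL models. This file closes that gap by the model-change brick of
`…AdditivePotMultConjATwoCubicModelTransport` (`conjA_two_iff_cubicModel_of_Δ_neg`: (A)₂(W) ⟺ (A)₂(⟨0,b₂,0,8b₄,16b₆⟩) for `Δ < 0`) — no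
new field theory.

* §1 **`conjA_two_of_classicalMu_cubicField_of_Δ_neg`** — EVERY elliptic `W/ℚ` with integer `b₂, b₄, b₆`, `Δ(W) < 0`, irreducible `W[2]`,
  `β = x(T) ∈ ℚ̄` a root of `4x³ + b₂x² + 2b₄x + b₆`: `μ₂ = 0` along the cyclotomic `ℤ₂`-extensions of `ℚ(β)` ⟹ (A)₂(W) (`∃ γ D` kernel
  form, every cyclotomic `κ`); `…_of_isGloballyMinimal` — the same for a globally minimal `W`.
* §2 `hAnaMI_negDisc_of_cubicFieldMu` — v11's binder (I1M′) on the half `Δ < 0` from the NUMBER-FIELD statement «`μ₂ = 0` for the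
  cyclotomic `ℤ₂`-extension of the cubic field `ℚ(x(T))` of every such `W`» (`hAnaMI_negDisc_of_divisionFieldMu`: the same from `μ₂ = 0` of
  the sextic `ℚ(E[2])`, pointwise w2); `hAnaMI_of_cubicFieldMu_of_posDisc` — the TYPE of (I1M′) VERBATIM from that statement and (I1M′)
  restricted to `0 < Δ` (displayed). No restate of 19098 / 22618 is asked (D-0152).

References: [CoatesSujatha2005] Conj. A, Thm. 3.4, Cor. 3.6; [LimSujatha2018] §3 Prop. 3.2; [Lim2017FineSelmer] §3 Thm. 3.5, Lemma 3.2;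
[Iwasawa1973MuInvariants] Thm. 2/3; [SilvermanAEC2009] III.§1, III.2.3, VIII.§1, VIII.§8; [Kato2004Asterisque] Conj. 12.10 (p. 224),
Thm. 12.5 (3); tree p728213 (w2 GEN 7), `…PotMultConjATwoCubicModelTransport` (this seat), `…ConjATwoCongruenceNegDisc` (addL2x GEN 12).
-/

set_option autoImplicit false
-- the Theorems namespace of this sub repeats the summit name by design (D-0017 nested layout)
set_option linter.dupNamespace false

noncomputable section

open scoped Classical NumberField Polynomial IntermediateField
open NumberField Field Polynomial IntermediateField

namespace Summit.BirchSwinnertonDyer.BirchSwinnertonDyer.Theorems.AddKatoTwo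

open WeierstrassCurve Literature.NumberTheory.EllipticCurves Literature.NumberTheory.EllipticCurves.ZpExtension
  Literature.NumberTheory.GaloisRepresentations Literature.NumberTheory.IwasawaTheory
  Literature.NumberTheory.EllipticCurves.Rank1Residual
  Summit.BirchSwinnertonDyer.BirchSwinnertonDyer.Theorems.SteinbergFibreAtTwo

/-! ## §1 The general-model cubic-field door -/

section Door

variable (W : WeierstrassCurve ℚ) [W.IsElliptic]

/-- **The general-model cubic-field door.** `W/ℚ` elliptic with INTEGER `b₂, b₄, b₆` (e.g. an integral model), `Δ(W) < 0`, `W[2]`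
irreducible, `β ∈ ℚ̄` a root of the `2`-division cubic `4x³ + b₂x² + 2b₄x + b₆` (the abscissa of a point of order `2`): if `μ = 0` for the
cyclotomic `ℤ₂`-extensions of the cubic field `ℚ(β)`, then statement (A) at `(W, 2)` holds (`∃ γ D, D.X` finitely generated over `ℤ₂`, every
cyclotomic `κ`). Proof: `4β` is a root of `X³ + b₂X² + 8b₄X + 16b₆` (irreducible, `disc < 0`) with `ℚ(4β) = ℚ(β)`; w2's cubic-model door gives
(A)₂ for `W′ = ⟨0, b₂, 0, 8b₄, 16b₆⟩`; transport `conjA_two_iff_cubicModel_of_Δ_neg`.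
[cite: CoatesSujatha2005, Conj. A and Thm. 3.4] [cite: LimSujatha2018, §3 Prop. 3.2] [cite: Iwasawa1973MuInvariants, Thm. 2 and Thm. 3]
[cite: SilvermanAEC2009, III.§1, III.2.3 and VIII.§1] -/
theorem conjA_two_of_classicalMu_cubicField_of_Δ_neg {B₂ B₄ B₆ : ℤ} (h₂ : W.b₂ = B₂) (h₄ : W.b₄ = B₄) (h₆ : W.b₆ = B₆)
    (hΔ : W.Δ < 0) (hirr : W.HasIrreducibleModPGaloisRep 2)
    {β : AlgebraicClosure ℚ} (hβ : aeval β W.twoTorsionPolynomial.toPoly = 0)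
    (hμ : ∀ κP : ZpExtension ↥(IntermediateField.adjoin ℚ ({β} : Set (AlgebraicClosure ℚ))) 2,
      κP.IsCyclotomic → ClassicalMuVanishes κP)
    (κ : ZpExtension ℚ 2) (hκ : κ.IsCyclotomic) :
    ∃ (γ : absoluteGaloisGroup ℚ) (D : W.FineSelmerDualData κ γ),
      Module.Finite ℤ_[2] (RestrictScalars ℤ_[2] (IwasawaAlgebra 2) D.X) := by
  haveI := isElliptic_cubicModel_of_b W h₂ h₄ h₆
  -- `4β` is a root of the monic cubic, and `ℚ(4β) = ℚ(β)` carries the same `μ₂` hypothesis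
  have hβ' : aeval (algebraMap ℚ (AlgebraicClosure ℚ) 4 * β)
      (Cubic.toPoly ⟨1, ((B₂ : ℤ) : ℚ), ((8 * B₄ : ℤ) : ℚ), ((16 * B₆ : ℤ) : ℚ)⟩) = 0 := by
    rw [aeval_cubicModel_four_mul W h₂ h₄ h₆, hβ, mul_zero]
  have hμ' : ∀ κP : ZpExtension ↥(IntermediateField.adjoin ℚ
      ({algebraMap ℚ (AlgebraicClosure ℚ) 4 * β} : Set (AlgebraicClosure ℚ))) 2, κP.IsCyclotomic → ClassicalMuVanishes κP := by
    rw [adjoin_four_mul_eq]; exact hμ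
  -- (A)₂ for the cubic model (w2's door), then transport
  have hA' := TotallyComplexMu.conjA_two_cubicModel_of_classicalMu_of_discr_neg B₂ (8 * B₄) (16 * B₆)
    (irreducible_cubicModel_of_hasIrreducibleModPGaloisRep_two W h₂ h₄ h₆ hirr) (cubicModel_discr_neg_of_Δ_neg W h₂ h₄ h₆ hΔ)
    hβ' hμ' κ hκ
  exact (conjA_two_iff_cubicModel_of_Δ_neg W h₂ h₄ h₆ hΔ κ hκ).mpr hA'

/-- **The general-model cubic-field door for a GLOBALLY MINIMAL `W`** (integer `bᵢ` from the integral model): `Δ(W) < 0`, `W[2]`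
irreducible, `β` a root of the `2`-division cubic, `μ₂ = 0` along the cyclotomic `ℤ₂`-extensions of `ℚ(β)` ⟹ (A)₂(W).
[cite: CoatesSujatha2005, Conj. A and Thm. 3.4] [cite: LimSujatha2018, §3 Prop. 3.2] [cite: SilvermanAEC2009, VIII.§8 and III.§1] -/
theorem conjA_two_of_classicalMu_cubicField_of_Δ_neg_of_isGloballyMinimal [W.IsGloballyMinimal]
    (hΔ : W.Δ < 0) (hirr : W.HasIrreducibleModPGaloisRep 2)
    {β : AlgebraicClosure ℚ} (hβ : aeval β W.twoTorsionPolynomial.toPoly = 0)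
    (hμ : ∀ κP : ZpExtension ↥(IntermediateField.adjoin ℚ ({β} : Set (AlgebraicClosure ℚ))) 2,
      κP.IsCyclotomic → ClassicalMuVanishes κP)
    (κ : ZpExtension ℚ 2) (hκ : κ.IsCyclotomic) :
    ∃ (γ : absoluteGaloisGroup ℚ) (D : W.FineSelmerDualData κ γ),
      Module.Finite ℤ_[2] (RestrictScalars ℤ_[2] (IwasawaAlgebra 2) D.X) :=
  conjA_two_of_classicalMu_cubicField_of_Δ_neg W (b₂_eq_integralModelInt W) (b₄_eq_integralModelInt W)
    (b₆_eq_integralModelInt W) hΔ hirr hβ hμ κ hκ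

end Door

/-! ## §2 The split of v11's binder (I1M′) `hAnaMI` by the sign of `Δ` -/

/-- **(I1M′) on the half `Δ < 0` from a NUMBER-FIELD statement.** If for every globally minimal, non-CM, analytic-rank-`0` curve `W`,
additive and potentially multiplicative at `2` (`ord₂ j < 0`) with irreducible `W[2]` and `Δ(W) < 0`, and every root `β ∈ ℚ̄` of its
`2`-division cubic, `μ = 0` along the cyclotomic `ℤ₂`-extensions of the cubic field `ℚ(β)`, then statement (A) at `(W, 2)` holds for all
such `W` (§1; the non-abelian guard of (I1M′) is not needed on this half). [cite: CoatesSujatha2005, Conj. A and Thm. 3.4]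
[cite: Iwasawa1973MuInvariants, Thm. 2 and Thm. 3] [cite: LimSujatha2018, §3 Prop. 3.2] -/
theorem hAnaMI_negDisc_of_cubicFieldMu
    (hμ3 : ∀ (W : WeierstrassCurve ℚ) [W.IsElliptic] [W.IsGloballyMinimal], ¬ W.HasCM → W.analyticRank = 0 →
      Addv W 2 → padicValRat 2 W.j < 0 → W.HasIrreducibleModPGaloisRep 2 → W.Δ < 0 →
      ∀ β : AlgebraicClosure ℚ, aeval β W.twoTorsionPolynomial.toPoly = 0 →
      ∀ κP : ZpExtension ↥(IntermediateField.adjoin ℚ ({β} : Set (AlgebraicClosure ℚ))) 2,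
        κP.IsCyclotomic → ClassicalMuVanishes κP) :
    ∀ (W : WeierstrassCurve ℚ) [W.IsElliptic] [W.IsGloballyMinimal], ¬ W.HasCM → W.analyticRank = 0 →
      Addv W 2 → padicValRat 2 W.j < 0 → W.HasIrreducibleModPGaloisRep 2 → W.Δ < 0 →
      ∀ (κ : ZpExtension ℚ 2), κ.IsCyclotomic →
        ∃ (γ : Field.absoluteGaloisGroup ℚ) (D : W.FineSelmerDualData κ γ),
          Module.Finite ℤ_[2] (RestrictScalars ℤ_[2] (IwasawaAlgebra 2) D.X) := by
  intro W _ _ hcm hr hadd hj hirr hΔ κ hκ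
  -- a root of the `2`-division cubic in `ℚ̄`
  have hdeg : W.twoTorsionPolynomial.toPoly.degree ≠ 0 := by
    rw [Cubic.degree_of_a_ne_zero (by change (4 : ℚ) ≠ 0; norm_num)]; decide
  obtain ⟨β, hβ⟩ := IsAlgClosed.exists_aeval_eq_zero_of_injective (AlgebraicClosure ℚ)
    (algebraMap ℚ (AlgebraicClosure ℚ)).injective W.twoTorsionPolynomial.toPoly hdeg
  exact conjA_two_of_classicalMu_cubicField_of_Δ_neg_of_isGloballyMinimal W hΔ hirr hβ
    (hμ3 W hcm hr hadd hj hirr hΔ β hβ) κ hκ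

/-- **(I1M′) on the half `Δ < 0` from `μ₂ = 0` of the SEXTIC `ℚ(E[2])` itself** (the weaker hypothesis: `μ₂(ℚ(β)) = 0 ⟹ μ₂(ℚ(E[2])) = 0`
by the ascent; no integrality, no transport — w2's `TotallyComplexMu.conjA_two_of_classicalMu_divisionField_two_of_Δ_neg` pointwise).
[cite: CoatesSujatha2005, Conj. A and Thm. 3.4] [cite: Lim2017FineSelmer, §3 Thm. 3.5 and Lemma 3.2] -/
theorem hAnaMI_negDisc_of_divisionFieldMu
    (hμ6 : ∀ (W : WeierstrassCurve ℚ) [W.IsElliptic] [W.IsGloballyMinimal], ¬ W.HasCM → W.analyticRank = 0 →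
      Addv W 2 → padicValRat 2 W.j < 0 → W.HasIrreducibleModPGaloisRep 2 → W.Δ < 0 →
      ∀ κF : ZpExtension (W.divisionField 2) 2, κF.IsCyclotomic → ClassicalMuVanishes κF) :
    ∀ (W : WeierstrassCurve ℚ) [W.IsElliptic] [W.IsGloballyMinimal], ¬ W.HasCM → W.analyticRank = 0 →
      Addv W 2 → padicValRat 2 W.j < 0 → W.HasIrreducibleModPGaloisRep 2 → W.Δ < 0 →
      ∀ (κ : ZpExtension ℚ 2), κ.IsCyclotomic →
        ∃ (γ : Field.absoluteGaloisGroup ℚ) (D : W.FineSelmerDualData κ γ),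
          Module.Finite ℤ_[2] (RestrictScalars ℤ_[2] (IwasawaAlgebra 2) D.X) :=
  fun W _ _ hcm hr hadd hj hirr hΔ κ hκ ↦
    TotallyComplexMu.conjA_two_of_classicalMu_divisionField_two_of_Δ_neg W hΔ (hμ6 W hcm hr hadd hj hirr hΔ) κ hκ

/-- **v11's binder (I1M′) `hAnaMI` VERBATIM from {the number-field statement on `Δ < 0`} and {(I1M′) restricted to `0 < Δ`}.** The
conclusion is the type of the hypothesis `hAnaMI` of `additiveRankZeroAtTwo_of_residual_v11` (statement (A) at `2` on the irreducible,
non-abelian-`ℚ(E[2])` additive pot-mult curves of C4″): on `Δ < 0` it is fed by `hAnaMI_negDisc_of_cubicFieldMu`, on `0 < Δ` it stays displayed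
(`hPos`; the Q⁺-type half, where `ℚ(E[2])` has real places). `Δ ≠ 0` for an elliptic curve. No restate is asked (D-0152).
[cite: CoatesSujatha2005, Conj. A] [cite: Kato2004Asterisque, Conj. 12.10 (p. 224)] [cite: LimSujatha2018, §3 Prop. 3.2] -/
theorem hAnaMI_of_cubicFieldMu_of_posDisc
    (hμ3 : ∀ (W : WeierstrassCurve ℚ) [W.IsElliptic] [W.IsGloballyMinimal], ¬ W.HasCM → W.analyticRank = 0 →
      Addv W 2 → padicValRat 2 W.j < 0 → W.HasIrreducibleModPGaloisRep 2 → W.Δ < 0 →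
      ∀ β : AlgebraicClosure ℚ, aeval β W.twoTorsionPolynomial.toPoly = 0 →
      ∀ κP : ZpExtension ↥(IntermediateField.adjoin ℚ ({β} : Set (AlgebraicClosure ℚ))) 2,
        κP.IsCyclotomic → ClassicalMuVanishes κP)
    (hPos : ∀ (W : WeierstrassCurve ℚ) [W.IsElliptic] [W.IsGloballyMinimal], ¬ W.HasCM → W.analyticRank = 0 →
      Addv W 2 → padicValRat 2 W.j < 0 → W.HasIrreducibleModPGaloisRep 2 → ¬ IsAbelianGalois ℚ (W.divisionField 2) → 0 < W.Δ →
      ∀ (κ : ZpExtension ℚ 2), κ.IsCyclotomic →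
        ∃ (γ : Field.absoluteGaloisGroup ℚ) (D : W.FineSelmerDualData κ γ),
          Module.Finite ℤ_[2] (RestrictScalars ℤ_[2] (IwasawaAlgebra 2) D.X)) :
    ∀ (W : WeierstrassCurve ℚ) [W.IsElliptic] [W.IsGloballyMinimal], ¬ W.HasCM → W.analyticRank = 0 →
      Addv W 2 → padicValRat 2 W.j < 0 → W.HasIrreducibleModPGaloisRep 2 → ¬ IsAbelianGalois ℚ (W.divisionField 2) →
      ∀ (κ : ZpExtension ℚ 2), κ.IsCyclotomic →
        ∃ (γ : Field.absoluteGaloisGroup ℚ) (D : W.FineSelmerDualData κ γ),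
          Module.Finite ℤ_[2] (RestrictScalars ℤ_[2] (IwasawaAlgebra 2) D.X) := by
  intro W _ _ hcm hr hadd hj hirr hab κ hκ
  rcases lt_or_gt_of_ne W.isUnit_Δ.ne_zero with hΔ | hΔ
  · exact hAnaMI_negDisc_of_cubicFieldMu hμ3 W hcm hr hadd hj hirr hΔ κ hκ
  · exact hPos W hcm hr hadd hj hirr hab hΔ κ hκ

end Summit.BirchSwinnertonDyer.BirchSwinnertonDyer.Theorems.AddKatoTwo

end
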